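import Summits.QuantumFields.YangMills.Theorems.BalabanUVNodesN18AtReadingOfRecord12
import Summits.QuantumFields.YangMills.Theorems.BalabanUVNodesN18HLayerW1ConfigRecord

/-!
# BalabanUVNodes ∕ node N18 = NE5 — THE s1 ∘ s2 JUNCTION AT THE READING OF RECORD: the END run on W1's own carriers (module 9) with its LEVELS
# LEAVES L05 ∕ L06 — the (1.18)-type decay bounds of run A's functional and of run B's first-coupling family — PRODUCED from the H-layer data of the
# towers themselves ([II] (2.13an) + Lemma 3 (2.38) in the configuration direction, dag-n18-c's `N18HLayerW1ConfigRecord.decayBound_EA∕EB_of_bound238_table`,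
# p474817 — ANY space table, in particular the table of record, which is NOT open), and the UNPRINTED pairing clause «the domain pairing does not shrink `d_j`» DISCHARGED at the pairing OF RECORD by node00-def-W1 g3's
# `dj_pairOfRecord` (Track A, DAG node N18 = `T4OutputRate.NE5` :211; cluster K4 «SpineRates», item K3′ `SpineGivenEndpointR12`; module 11 of seat
# pub-ymgap-dag-n18-d, strategy s2)

HONEST FRAMING.  Count-neutral kernel bookkeeping (`--supports stmt-QuantumFields-19908 --as helper`), composition BY NAME of landed theorems; NE5 is NOT
PRINTED and NOT proved; N18 is NOT discharged.  Module 9 (`…N18EndAtW1Carriers`, p473525) runs the H-layer END on the level pairing's own carriers with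
the twelve leaves as hypotheses; module 10 (`…N18AtReadingOfRecord12`, p474555) reads it at the reading of record with W1's maps and the transport of record
pinned.  Two of those leaves — L05 `DecayBound EA W EA₀ κ` and L06 `DecayBound (EB b) W E₀ κ` ([I] (1.18) for the two runs' (2.13) terms) — are exactly what
dag-n18-c's row s1 modules `…N18HLayerW1Config` ∕ `…N18HLayerW1ConfigRecord` PRODUCE at a W1 level pairing from the per-step H-layer data of the towers:
`ClusterStep.AnalyticH` ((2.13an), [II] p. 15) and `ClusterStep.Bound238` ((2.38), amplitude `A`, rate `R_d`) on ANY restriction-closed space table holding the runs'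
readings (NO openness — the table of record `W1.spaceOfRecord` is NOT open in `Φ`, n18-c's `…N18HLayerW1SpaceNotOpen` p475275; the neighbourhood extension is
inside the producer), the located rate clause and the STRICT [KP86] clause — via [KP86] + the NE1′ faces.  This file substitutes them:
* §1 `n18At_pairing_of_envelope_bound238` — at ANY level pairing `R : Node00.W1.LevelPairing F 𝔸 M k` with run A's tower `S` (on `F.P k`) and run B's
  tower `S′` (on `F.P (k+1)`): the END's data (per-member step models over `R.carriers`, (2.13) `hrep`, NODE-A majorant `hH` at `C₃ε₁`, leaves L01–L03 ∕
  L07–L09unit on `R.EA S` ∕ `R.EB S′ b`, located numerals, sharp clause) + THE TOWERS' H-LAYER DATA (both runs, amplitudes `A_A ∕ A_B`, the END's rates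
  `κ ∕ R_d`, restriction-closed tables, readings inside, STRICT `A·e^{5κ+1}·K₀(64,8)·576 < 1`) + the pairing clause `d_j(X) ≤ d(pair X)` ⇒
  `N18At ⟨R.carriers, ]0,γ]^ℕ, γ, κ, R.EA S, R.EB S′, θ′, C₅(C₃ε₁), …⟩` with the levels letters `EA₀ := e·576·K₀(64,8)²·A_A`, `E₀ := e·576·K₀(64,8)²·A_B`
  entering L08 ∕ L10 (module 9 §2 with `l05 ∕ l06 :=` dag-n18-c's two any-table theorems).
* §2 `s_N18_readingOfRecord₁₂_ofRecord_of_envelope_bound238` — AT THE READING OF RECORD (towers `S F θ`, W1's maps of record, transport of record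
  `transportRaw F k (avOfRecord F N (k+1) 0)`): the same per admissible Stage-12 tuple with provisos and run length, the readings `(ιU, 0)` of both runs'
  gauge fields landing in the tables DISPLAYED, the pairing clause GONE (`dj_pairOfRecord`: the pairing of record PRESERVES `d_j`) ⇒ `S_N18 (RRec₁₂ 𝔯_record)`.
What REMAINS in the hypothesis after this junction: the H-layer ACTIVITY DATUM in the DATA direction (the END's `StepModel` over the level pairing of record
with (2.13) `hrep` and the NODE-A majorant `hH` on its activities), the representation leaves L01–L03, rows NE2 ∕ NE3's rates L07 ∕ L08, the W3 shapes L09*,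
[KP86]'s reach L10 and the sharp clause (dag-n18-c s1 ∕ NODE O ∕ rows NE2–NE3); in the CONFIGURATION direction the towers' `AnalyticH` ∕ `Bound238` (NODE A's
(2.38) for the (2.14) terms of record, N10's Lemmas 1–3 — n18-c's `…N18HLayerW1Lemma3Config` produces `Bound238` from the per-term (2.26) data) with the space
tables ([I] p. 263 «the configurations … restricted to X belong to U^c_j», [II] (2.16)–(2.18)); the towers `S` themselves (node00-def-W1 g4); K0′.  One finite four-torus programme at fixed `ε`; NOT the continuum limit, NOT OS, NOT a mass
gap, NOT Clay.  0 `def`, 0 `sorry`.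

Sources: T. Bałaban, CMP **109** (1987) [Balaban1987RG1] (0.4) p. 253, (0.24)–(0.25) p. 257, Thm 1 p. 259, (1.17)–(1.18) and the analyticity sentence p. 263;
CMP **116** (1988) [Balaban1988RG2Cluster] (2.13)–(2.14) pp. 14–15 with the analyticity statement p. 15, (2.16)–(2.18) p. 16, Lemma 3 (2.38) p. 20, (2.39)–(2.41)
p. 21; CMP **119** (1988) [Balaban1988Convergent] (2.27) p. 259; R. Kotecký–D. Preiss, CMP **103** (1986) [KoteckyPreiss1986].  Nothing here is a claim about
the Yang–Mills mass gap.
-/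

noncomputable section

open Set Metric
open scoped Matrix.Norms.L2Operator

namespace YMDAG.N18.W1Reading

open Literature.MathematicalPhysics.QuantumFieldTheory.Balaban1983to89
open Literature.MathematicalPhysics.QuantumFieldTheory.Balaban1983to89.T4Continuum
open Literature.MathematicalPhysics.QuantumFieldTheory.Balaban1983to89.T4OutputRate (Carriers Functional NE5 DecayBound Window)
open Literature.MathematicalPhysics.QuantumFieldTheory.Balaban1983to89.T4InputCauchyRateData (StepModel)
open Literature.MathematicalPhysics.QuantumFieldTheory.Balaban1983to89.B13Resummation (locE)
open Literature.MathematicalPhysics.QuantumFieldTheory.Balaban1983to89.TreeLengthTorus (TDom tsys torusTreeLen)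
open Literature.MathematicalPhysics.QuantumFieldTheory.Balaban1983to89.TreeLengthTorusGeometry (TTouch)
open Literature.MathematicalPhysics.QuantumFieldTheory.Balaban1983to89.B12TreeDecay (K₀)
open Literature.MathematicalPhysics.QuantumFieldTheory.Balaban1983to89.Node00 (Stage12Params IsDatumOfRecord₁₂C U3Letters₁₁ U3Objects₁₁ NE2Objects₁₁
  NE3Letters₁₁ RateAssignment₁₂ prependCoupling MatA ιSU avOfRecord)
open Literature.MathematicalPhysics.QuantumFieldTheory.Balaban1983to89.Node00.Sect2 (domCount domSys CPair ofBackgroundC)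
open Literature.MathematicalPhysics.QuantumFieldTheory.Balaban1983to89.Node00.W1 (ReadingData LevelPairing LetterInputs ClusterTower pairOfRecord
  dj_pairOfRecord functionalC functional box SpRestr)
open Summit.QuantumFields.BalabanUV.T4Continuum.B13Carriers (transportRaw)
open Summit.QuantumFields.BalabanUV.T4Continuum.Spine.NE5
open Summit.QuantumFields.YangMills.BalabanUVNodes.N18AtByName (n18At_mono)
open Summit.QuantumFields.YangMills.BalabanUVNodes.N18HLayerW1ConfigRecord (decayBound_EA_of_bound238_table decayBound_EB_of_bound238_table)
open YMDAG.N18.HLayer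
open YMDAG.UVSplit

variable {N : ℕ} [NeZero N]

/-! ## §1 At any W1 level pairing: the END with its levels leaves produced from the towers' H-layer data -/

section Pairing

variable {F : T4Family} {𝔸 : Type*} [NormedRing 𝔸] [NormedAlgebra ℂ 𝔸] {M k : ℕ} (R : LevelPairing F 𝔸 M k)
  (S : ClusterTower (F.P k) 𝔸 M) (S' : ClusterTower (F.P (k + 1)) 𝔸 M)
variable {Op Hist : Type*} [NormedAddCommGroup Op] [NormedSpace ℂ Op] [NormedAddCommGroup Hist] [NormedSpace ℂ Hist]
variable [∀ j, DecidableEq (TDom 4 (domCount (F.P k) M j))] [∀ j, DecidableRel (TTouch (d := 4) (N := domCount (F.P k) M j))]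

open Classical in
/-- **N18 AT A W1 LEVEL PAIRING FROM THE H-LAYER END, LEVELS LEAVES FROM THE TOWERS' H-LAYER DATA** [bookkeeping; module 9 §2 ∘ dag-n18-c's
`decayBound_EA_of_bound238` ∕ `decayBound_EB_of_bound238`].  Objects: the level-`k` pairing `R` (runs A ∕ B on `F.P k` ∕ `F.P (k+1)`), run A's tower `S`, run B's
tower `S′`; the functionals ARE `R.EA S` (`Re E^{(j)}(X; g; embA U)`) and `R.EB S′` (`Re E_B(pair (j,X); b∷g; embB U)`).  Hypotheses: (i) the END's data on
`R.carriers` — per-member step models `Mb b` (`b ∈ ]0, γ]`) representing (2.13) of activities on the `k`-th torus's catalogue (`hrep`) with THE NODE-A MAJORANT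
AS HYPOTHESIS at `C₃ε₁` (`hH`), the representation leaves L01–L03, rows NE2 ∕ NE3's L07 ∕ L08, the W3 shapes L09aff ∕ blind ∕ hom ∕ unit, the located
numerals, L10 near ∕ first, the sharp clause; (ii) THE TOWERS' H-LAYER DATA IN THE CONFIGURATION DIRECTION — for run A: a restriction-closed space table `spA` on the
`k`-th torus's catalogue (ANY table; the table of record qualifies) holding the run-A readings (`hembA`), `(S m).AnalyticH (box γ m) (spA (m+1))` and
`(S m).Bound238 (box γ m) (spA (m+1)) A_A R_d` at every step, `A_A ≥ 0`, STRICT `A_A·e^{5κ+1}·K₀(64,8)·576 < 1`; for run B the same on `F.P (k+1)` with `S′`, `spB`,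
`A_B`, `hembB`, AND the pairing clause `d_j(X) ≤ d(pair (j,X))` (`hpair`, DISPLAYED — unprinted; an equality at the pairing of record, §2).  Conclusion:
`N18At ⟨R.carriers, ]0,γ]^ℕ, γ, κ, R.EA S, R.EB S′, θ′, C₅(C₃ε₁), …⟩` with `EA₀ := e·576·K₀(64,8)²·A_A`, `E₀ := e·576·K₀(64,8)²·A_B` in L08 ∕ L10.
[cite: Balaban1988RG2Cluster, (2.13) p.14, p.15 and Lemma 3 (2.38) p.20, (2.41) p.21; Balaban1987RG1, (1.18) p.263 and Thm 1 p.259; KoteckyPreiss1986, Thm 1 p.492] -/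
theorem n18At_pairing_of_envelope_bound238 (Mb : ℝ → StepModel R.carriers Op Hist)
    {act : ℝ → (j : ℕ) → Op × Hist → TDom 4 (domCount (F.P k) M j) → ℂ} {γ C3 ε₁ Rd κ A_A A_B E₁ δ δ' θ θ' cH ω ρ₀ B : ℝ} {k₀ : ℕ}
    (spA : (j : ℕ) → (domSys (F.P k) M j).Dom → Set (CPair (F.P k) 𝔸))
    (spB : (j : ℕ) → (domSys (F.P (k + 1)) M j).Dom → Set (CPair (F.P (k + 1)) 𝔸))
    -- (i) the END's data on the pairing's carriers
    (hrep : ∀ b : ℝ, 0 < b → b ≤ γ → ∀ (X : Node00.W1.Dom (F.P k) M) (z : Op × Hist),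
      (Mb b).Out X.1 z.1 z.2 X =
        locE (TTouch (d := 4) (N := domCount (F.P k) M X.1)) (fun Z : (tsys 4 (domCount (F.P k) M X.1)).Dom => Z.1) (act b X.1 z) X.2.1)
    (hC3 : 0 ≤ C3) (hε₁ : 0 ≤ ε₁) (hκ : 0 ≤ κ) (hrate : κ + 2 * (64 * Real.log 162) + 2 ≤ Rd)
    (hKP : C3 * ε₁ * Real.exp (5 * κ + 1) * K₀ 64 8 * 9 * 64 ≤ 1)
    (hH : ∀ b : ℝ, 0 < b → b ≤ γ → ∀ j, ∀ g ∈ Window γ, ∀ (U : R.BgB) (q : Op × Hist), q ∈ (Mb b).Base j g U →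
      ∃ V : Set (Op × Hist), IsOpen V ∧ (Mb b).box j q ⊆ V ∧
        (∀ Z : TDom 4 (domCount (F.P k) M j), DifferentiableOn ℂ (fun z : Op × Hist => act b j z Z) V) ∧
        (∀ z ∈ V, ∀ Z : TDom 4 (domCount (F.P k) M j), ‖act b j z Z‖ ≤ C3 * ε₁ * Real.exp (-(Rd * torusTreeLen Z.1))))
    (l01 : ∀ b : ℝ, 0 < b → b ≤ γ → L01 (Mb b) (R.EA S) (Window γ))
    (l02 : ∀ b : ℝ, 0 < b → b ≤ γ → L02 (Mb b) (R.EB S' b) (Window γ))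
    (l03 : ∀ b : ℝ, 0 < b → b ≤ γ → L03 (Mb b) (R.EB S' b) (Window γ))
    (l07 : ∀ b : ℝ, 0 < b → b ≤ γ → L07 (Mb b) (Window γ) δ θ)
    (l08 : ∀ b : ℝ, 0 < b → b ≤ γ → L08 (Mb b) (Window γ) κ (Real.exp 1 * 9 * 64 * K₀ 64 8 ^ 2 * A_B) δ' θ)
    (l09aff : ∀ b : ℝ, 0 < b → b ≤ γ → L09aff (Mb b) (Window γ)) (l09blind : ∀ b : ℝ, 0 < b → b ≤ γ → L09blind (Mb b) (Window γ))
    (l09hom : ∀ b : ℝ, 0 < b → b ≤ γ → L09hom (Mb b) (Window γ))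
    (l09unit : ∀ b : ℝ, 0 < b → b ≤ γ → L09unit (Mb b) (Window γ) κ E₁ cH ω)
    (hE₁ : 0 < E₁) (hδ : 0 ≤ δ + δ') (hθ : 0 ≤ θ) (hθθ' : θ ≤ θ') (hθ'1 : θ' ≤ 1) (hcH : 0 ≤ cH) (hω : 0 < ω) (hρ₀ : ρ₀ < 1)
    (l10near : (δ + δ') * θ ^ k₀ +
      cH * (Real.exp 1 * 9 * 64 * K₀ 64 8 ^ 2 * A_A + Real.exp 1 * 9 * 64 * K₀ 64 8 ^ 2 * A_B) / (1 - ω) ≤ ρ₀)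
    (hB : 0 ≤ B) (l10first : ∀ k < k₀, Real.exp 1 * 9 * 64 * K₀ 64 8 ^ 2 * A_A + Real.exp 1 * 9 * 64 * K₀ 64 8 ^ 2 * A_B ≤ B * θ ^ k)
    (hS : Real.exp 1 * 9 * 64 * K₀ 64 8 ^ 2 * C3 * cH * ε₁ < (θ' - ω) * (1 - ρ₀))
    -- (ii) the towers' H-layer data in the configuration direction: run A on `F.P k`
    (hembA : ∀ (j : ℕ) (U : R.BgA) (X : (domSys (F.P k) M j).Dom), R.embA U ∈ spA j X) (hrestrA : ∀ m, SpRestr (spA (m + 1)))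
    (hanA : ∀ m, (S m).AnalyticH (box γ m) (spA (m + 1))) (h238A : ∀ m, (S m).Bound238 (box γ m) (spA (m + 1)) A_A Rd) (hAA : 0 ≤ A_A)
    (hsmallA : A_A * Real.exp (5 * κ + 1) * K₀ 64 8 * 9 * 64 < 1)
    -- run B on `F.P (k+1)`, and the pairing clause
    (hembB : ∀ (j : ℕ) (U : R.BgB) (Y : (domSys (F.P (k + 1)) M j).Dom), R.embB U ∈ spB j Y)
    (hpair : ∀ X : Node00.W1.Dom (F.P k) M, (domSys (F.P k) M X.1).dj X.2 ≤ (domSys (F.P (k + 1)) M (R.pair X).1).dj (R.pair X).2)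
    (hrestrB : ∀ m, SpRestr (spB (m + 1)))
    (hanB : ∀ m, (S' m).AnalyticH (box γ m) (spB (m + 1))) (h238B : ∀ m, (S' m).Bound238 (box γ m) (spB (m + 1)) A_B Rd) (hAB : 0 ≤ A_B)
    (hsmallB : A_B * Real.exp (5 * κ + 1) * K₀ 64 8 * 9 * 64 < 1)
    (Λ : ℕ → ℕ → ℝ) (C₉ ωm cr ρ : ℝ) :
    N18At ⟨R.carriers, Window γ, γ, κ, R.EA S, R.EB S', θ',
      (Real.exp 1 * 9 * 64 * K₀ 64 8 ^ 2 * (C3 * ε₁) / (1 - ρ₀) * (δ + δ') + B) * (θ' - ω) /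
        (θ' - (ω + Real.exp 1 * 9 * 64 * K₀ 64 8 ^ 2 * (C3 * ε₁) / (1 - ρ₀) * cH)), Λ, C₉, ωm, cr, ρ⟩ :=
  have l05 : L05 (R.EA S) (Window γ) (Real.exp 1 * 9 * 64 * K₀ 64 8 ^ 2 * A_A) κ :=
    decayBound_EA_of_bound238_table R S spA hembA hrestrA hanA h238A hAA hκ hrate hsmallA
  have l06 : ∀ b : ℝ, 0 < b → b ≤ γ → L06 (R.EB S' b) (Window γ) (Real.exp 1 * 9 * 64 * K₀ 64 8 ^ 2 * A_B) κ :=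
    fun b hb hbγ => decayBound_EB_of_bound238_table R S' spB hembB hpair hrestrB hanB h238B hAB hκ hrate hsmallB (b := b) ⟨hb, hbγ⟩
  n18At_pairing_of_envelopeOnW1Carriers R Mb hrep hC3 hε₁ hκ hrate hKP hH l01 l02 l03 l05 l06 l07 l08 l09aff l09blind l09hom l09unit hE₁ hδ hθ
    hθθ' hθ'1 hcH hω hρ₀ l10near hB l10first hS Λ C₉ ωm cr ρ

end Pairing

/-! ## §2 At the reading of record: the pairing clause discharged by `dj_pairOfRecord`, the readings of both runs displayed -/

open Classical in
/-- **THE ROW AT THE READING OF RECORD WITH THE LEVELS LEAVES PRODUCED FROM THE TOWERS' H-LAYER DATA** [bookkeeping; the s1 ∘ s2 junction].  At the reading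
of record (towers `S F θ`, W1's maps of record, transport of record `transportRaw F k (avOfRecord F N (k+1) 0)`): if at EVERY admissible Stage-12 tuple `θ` with
provisos and every run length `k` there are (i) the END's data over the carriers of the level pairing of record — data spaces, per-member step models representing
(2.13) of activities on the `k`-th torus's catalogue with THE NODE-A MAJORANT AS HYPOTHESIS, L01–L03 on the functionals OF RECORD, rows NE2 ∕ NE3's L07 ∕ L08, the
W3 shapes, the located numerals with the levels letters `e·576·K₀(64,8)²·A_A ∕ A_B`, L10, the sharp clause — and (ii) THE TOWERS' H-LAYER DATA IN THE
CONFIGURATION DIRECTION — restriction-closed space tables on the catalogues of `F.P k` and `F.P (k+1)` (ANY; e.g. the tables of record), the readings `(ιU, 0)` of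
both runs' gauge fields landing inside them ([I] p. 263, DISPLAYED), `AnalyticH` + `Bound238` of `S F θ k` and `S F θ (k+1)` at every step with amplitudes `A_A ∕ A_B`
and the END's rate, the two STRICT smallness clauses — with the letters `li F θ` dominating, then `S_N18 (RRec₁₂ 𝔯_record)`.  The pairing clause is GONE: the pairing of record
PRESERVES `d_j` (`Node00.W1.dj_pairOfRecord`).  §1 at `R := LevelPairing.ofRecord …`, then `N18AtByName.n18At_mono` with module 9's `endConstant_nonneg` and
module 8's bundle equation, once per key and level. [cite: Balaban1988RG2Cluster, (2.13) p.14, p.15 and Lemma 3 (2.38) p.20; Balaban1987RG1, (0.4) p.253, (0.24)–(0.25) p.257, (1.18) p.263 and Thm 1 p.259] -/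
theorem s_N18_readingOfRecord₁₂_ofRecord_of_envelope_bound238
    (S : (F : T4Family) → (θ : Stage12Params F N) → (k : ℕ) → ClusterTower (F.P k) (MatA N) θ.τ9.M)
    (gauge : (F : T4Family) → (θ : Stage12Params F N) → (k : ℕ) → GaugeField (F.P k) 0 (Node00.SU N) → GaugeField (F.P k) 0 (Node00.SU N) → ℝ)
    (hg : ∀ (F : T4Family) (θ : Stage12Params F N) (k : ℕ) (U U' : GaugeField (F.P k) 0 (Node00.SU N)), 0 ≤ gauge F θ k U U')
    (li : (F : T4Family) → Stage12Params F N → LetterInputs) (ℓ₃ : T4Family → NE3Letters₁₁)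
    (ne2 : (F : T4Family) → Stage12Params F N → (ℕ → ℝ) → List (ULoop F) → ℕ → NE2Objects₁₁)
    (ne1 : (F : T4Family) → Stage12Params F N → (ℕ → ℝ) → List (ULoop F) → NE1pCarriers)
    (h : ∀ (F : T4Family) (θ : Stage12Params F N), θ.Provisos₁₂ F N → θ.Admissible F N → ∀ k : ℕ,
      ∃ (Op : Type) (_ : NormedAddCommGroup Op) (_ : NormedSpace ℂ Op) (Hist : Type) (_ : NormedAddCommGroup Hist) (_ : NormedSpace ℂ Hist)
        (Mb : ℝ → StepModel (LevelPairing.ofRecord F θ.τ9.M k N (gauge F θ k) (hg F θ k)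
          (transportRaw F k (avOfRecord F N (k + 1) 0))).carriers Op Hist)
        (act : ℝ → (j : ℕ) → Op × Hist → TDom 4 (domCount (F.P k) θ.τ9.M j) → ℂ) (γ' C3 ε₁ Rd κ A_A A_B E₁ δ δ' θr θ' cH ω ρ₀ B : ℝ)
        (k₀ : ℕ) (spA : (j : ℕ) → (domSys (F.P k) θ.τ9.M j).Dom → Set (CPair (F.P k) (MatA N)))
        (spB : (j : ℕ) → (domSys (F.P (k + 1)) θ.τ9.M j).Dom → Set (CPair (F.P (k + 1)) (MatA N))),
        -- (i) the END's data over the carriers of the level pairing of record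
        (∀ b : ℝ, 0 < b → b ≤ γ' → ∀ (X : Node00.W1.Dom (F.P k) θ.τ9.M) (z : Op × Hist),
          (Mb b).Out X.1 z.1 z.2 X =
            locE (TTouch (d := 4) (N := domCount (F.P k) θ.τ9.M X.1)) (fun Z : (tsys 4 (domCount (F.P k) θ.τ9.M X.1)).Dom => Z.1)
              (act b X.1 z) X.2.1) ∧
        0 ≤ C3 ∧ 0 ≤ ε₁ ∧ 0 ≤ κ ∧ κ + 2 * (64 * Real.log 162) + 2 ≤ Rd ∧
        C3 * ε₁ * Real.exp (5 * κ + 1) * K₀ 64 8 * 9 * 64 ≤ 1 ∧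
        (∀ b : ℝ, 0 < b → b ≤ γ' → ∀ j, ∀ g ∈ Window γ', ∀ (U : GaugeField (F.P (k + 1)) 0 (Node00.SU N)) (q : Op × Hist),
          q ∈ (Mb b).Base j g U →
          ∃ V : Set (Op × Hist), IsOpen V ∧ (Mb b).box j q ⊆ V ∧
            (∀ Z : TDom 4 (domCount (F.P k) θ.τ9.M j), DifferentiableOn ℂ (fun z : Op × Hist => act b j z Z) V) ∧
            (∀ z ∈ V, ∀ Z : TDom 4 (domCount (F.P k) θ.τ9.M j), ‖act b j z Z‖ ≤ C3 * ε₁ * Real.exp (-(Rd * torusTreeLen Z.1)))) ∧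
        (∀ b : ℝ, 0 < b → b ≤ γ' → L01 (Mb b)
          ((LevelPairing.ofRecord F θ.τ9.M k N (gauge F θ k) (hg F θ k) (transportRaw F k (avOfRecord F N (k + 1) 0))).EA (S F θ k))
          (Window γ')) ∧
        (∀ b : ℝ, 0 < b → b ≤ γ' → L02 (Mb b)
          ((LevelPairing.ofRecord F θ.τ9.M k N (gauge F θ k) (hg F θ k) (transportRaw F k (avOfRecord F N (k + 1) 0))).EB (S F θ (k + 1)) b)
          (Window γ')) ∧
        (∀ b : ℝ, 0 < b → b ≤ γ' → L03 (Mb b)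
          ((LevelPairing.ofRecord F θ.τ9.M k N (gauge F θ k) (hg F θ k) (transportRaw F k (avOfRecord F N (k + 1) 0))).EB (S F θ (k + 1)) b)
          (Window γ')) ∧
        (∀ b : ℝ, 0 < b → b ≤ γ' → L07 (Mb b) (Window γ') δ θr) ∧
        (∀ b : ℝ, 0 < b → b ≤ γ' → L08 (Mb b) (Window γ') κ (Real.exp 1 * 9 * 64 * K₀ 64 8 ^ 2 * A_B) δ' θr) ∧
        (∀ b : ℝ, 0 < b → b ≤ γ' → L09aff (Mb b) (Window γ')) ∧ (∀ b : ℝ, 0 < b → b ≤ γ' → L09blind (Mb b) (Window γ')) ∧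
        (∀ b : ℝ, 0 < b → b ≤ γ' → L09hom (Mb b) (Window γ')) ∧ (∀ b : ℝ, 0 < b → b ≤ γ' → L09unit (Mb b) (Window γ') κ E₁ cH ω) ∧
        0 < E₁ ∧ 0 ≤ δ + δ' ∧ 0 ≤ θr ∧ θr ≤ θ' ∧ θ' ≤ 1 ∧ 0 ≤ cH ∧ 0 < ω ∧ ρ₀ < 1 ∧
        (δ + δ') * θr ^ k₀ +
            cH * (Real.exp 1 * 9 * 64 * K₀ 64 8 ^ 2 * A_A + Real.exp 1 * 9 * 64 * K₀ 64 8 ^ 2 * A_B) / (1 - ω) ≤ ρ₀ ∧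
        0 ≤ B ∧ (∀ k < k₀, Real.exp 1 * 9 * 64 * K₀ 64 8 ^ 2 * A_A + Real.exp 1 * 9 * 64 * K₀ 64 8 ^ 2 * A_B ≤ B * θr ^ k) ∧
        Real.exp 1 * 9 * 64 * K₀ 64 8 ^ 2 * C3 * cH * ε₁ < (θ' - ω) * (1 - ρ₀) ∧
        -- (ii) the towers' H-layer data in the configuration direction, both runs, readings inside the tables
        (∀ (j : ℕ) (U : GaugeField (F.P k) 0 (Node00.SU N)) (X : (domSys (F.P k) θ.τ9.M j).Dom), ofBackgroundC (ιSU N) U ∈ spA j X) ∧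
        (∀ m, SpRestr (spA (m + 1))) ∧
        (∀ m, (S F θ k m).AnalyticH (box γ' m) (spA (m + 1))) ∧ (∀ m, (S F θ k m).Bound238 (box γ' m) (spA (m + 1)) A_A Rd) ∧ 0 ≤ A_A ∧
        A_A * Real.exp (5 * κ + 1) * K₀ 64 8 * 9 * 64 < 1 ∧
        (∀ (j : ℕ) (U : GaugeField (F.P (k + 1)) 0 (Node00.SU N)) (Y : (domSys (F.P (k + 1)) θ.τ9.M j).Dom), ofBackgroundC (ιSU N) U ∈ spB j Y) ∧
        (∀ m, SpRestr (spB (m + 1))) ∧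
        (∀ m, (S F θ (k + 1) m).AnalyticH (box γ' m) (spB (m + 1))) ∧ (∀ m, (S F θ (k + 1) m).Bound238 (box γ' m) (spB (m + 1)) A_B Rd) ∧
        0 ≤ A_B ∧ A_B * Real.exp (5 * κ + 1) * K₀ 64 8 * 9 * 64 < 1 ∧
        -- the reading's letters dominate the END's
        θ.γ ≤ γ' ∧ (li F θ).κ ≤ κ ∧ θ' ≤ (li F θ).θ₅ ∧
        (Real.exp 1 * 9 * 64 * K₀ 64 8 ^ 2 * (C3 * ε₁) / (1 - ρ₀) * (δ + δ') + B) * (θ' - ω) /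
            (θ' - (ω + Real.exp 1 * 9 * 64 * K₀ 64 8 ^ 2 * (C3 * ε₁) / (1 - ρ₀) * cH)) ≤ (li F θ).C₅) :
    S_N18 (RRec₁₂ (readingOfRecord₁₂ (fun F θ => ReadingData.ofRecord F θ.τ9.M N (S F θ) (gauge F θ) (hg F θ)
      (fun k => transportRaw F k (avOfRecord F N (k + 1) 0)) (li F θ)) ℓ₃ ne2 ne1)) := by
  refine s_N18_rRec₁₂_of_forall_admissible _ fun F θ hP hA g₀ os k => ?_
  obtain ⟨Op, _, _, Hist, _, _, Mb, act, γ', C3, ε₁, Rd, κ, A_A, A_B, E₁, δ, δ', θr, θ', cH, ω, ρ₀, B, k₀, spA, spB, hrep, hC3, hε₁, hκ, hrate, hKP, hH,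
    l01, l02, l03, l07, l08, l09aff, l09blind, l09hom, l09unit, hE₁, hδ, hθ, hθθ', hθ'1, hcH, hω, hρ₀, l10near, hB, l10first, hS, hembA, hrestrA,
    hanA, h238A, hAA, hsmallA, hembB, hrestrB, hanB, h238B, hAB, hsmallB, hγ, hℓκ, hℓθ, hℓC⟩ := h F θ hP hA k
  have hN := n18At_pairing_of_envelope_bound238
    (LevelPairing.ofRecord F θ.τ9.M k N (gauge F θ k) (hg F θ k) (transportRaw F k (avOfRecord F N (k + 1) 0))) (S F θ k) (S F θ (k + 1)) Mb spA spB
    hrep hC3 hε₁ hκ hrate hKP hH l01 l02 l03 l07 l08 l09aff l09blind l09hom l09unit hE₁ hδ hθ hθθ' hθ'1 hcH hω hρ₀ l10near hB l10first hS hembA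
    hrestrA hanA h238A hAA hsmallA hembB (fun X => (dj_pairOfRecord F θ.τ9.M k X).symm.le) hrestrB hanB h238B hAB hsmallB
    ((li F θ).analytic θ.γ).moduli ((li F θ).analytic θ.γ).C₉ ((li F θ).analytic θ.γ).ω (li F θ).cr (li F θ).ρ
  have hW : Window θ.γ ⊆ Window γ' := fun g hgW i => ⟨(hgW i).1, (hgW i).2.trans hγ⟩
  exact (n18At_u3OfRecord₁₂_w1_iff_pairing (pinnedInputs₁₂ (fun F θ => ReadingData.ofRecord F θ.τ9.M N (S F θ) (gauge F θ) (hg F θ)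
      (fun k => transportRaw F k (avOfRecord F N (k + 1) 0)) (li F θ)) ℓ₃ ne2) F θ g₀ os k).2
    (n18At_mono hN hW hγ hℓκ (hθ.trans hθθ') hℓθ (endConstant_nonneg hC3 hε₁ hδ hcH hρ₀ hB hS) hℓC)

end YMDAG.N18.W1Reading

end
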